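import Mathlib
import Literature.NumberTheory.LFunctions.Zhang2022.Section17Eq178ChiMain
import Literature.NumberTheory.LFunctions.Zhang2022.Section17Eq173Holds
import Literature.NumberTheory.LFunctions.Zhang2022.TypedSection17RelE
import HarnessLib

/-!
# Zhang (2022) §17 (17.8) in the χ-twisted reading, DISCHARGED: `Typed.Section17.eq17_8Chi_holds`

Topic `Literature/NumberTheory/LFunctions/Zhang2022` (Landau–Siegel audit tree; verdict-neutral).
Y. Zhang, *Discrete mean estimates and the Landau–Siegel zero*, arXiv:2211.02515v1 (2022)
[Zhang2022LandauSiegel] — **an unrefereed manuscript under adjudication; nothing here asserts or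
denies its Theorems 1–2.** §17 p. 98, (17.8): "`Φ₃⁻(p) = pΣ_n (b∗ν₁*)(n)ϱ*(n)/n + o(p)`", in the
χ-twisted reading of record RT16-int-1 (`b ↦ bχ`, typed `Typed.Section17.Eq17_8Chi`). Last file of
the (17.8)χ discharge (`Section17Phi3minusLine` → `…OffDiag` → `…Sizes` → `Section17Eq178ChiSupport`
→ `…Main` → this): the five error terms of `Phi3Minus.norm_Phi3minus_sub_main_le` are each `o(p)`:

* the `l = D⁴` boundary sum is `≪ τ(D⁴)D⁻²𝓛^{O(1)}` (`boundary_sum_le`, AM–GM with weight `D²`);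
* every polylogarithmic factor is `≪ 𝓛^{O(1)}` (`X ≤ P = e^{𝓛⁹}`), and `K𝓛^k ≤ εD` eventually
  (`ell_pow_le_eps_mul`), while `D ≤ P^{1/2}`, `D ≤ T²`, `e^{(1−𝓛₁²)/(4𝓛₂²)} ≤ P⁻²`,
  `P^{5/2}(1/3)^{𝓛₂²−2} ≤ D⁻¹`;
* **`eq17_8Chi_holds : ∀ c′, Eq17_8Chi c′`** — UNCONDITIONAL (Assumption (A) is not used: the
  right side of (17.8) is an identity-plus-trivial-estimation statement).

Theorems only, 0 defs, 0 new facts, axioms std.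

## References

* Y. Zhang, arXiv:2211.02515v1 (2022), §17 p. 98 ((17.8)). [cite: Zhang2022LandauSiegel, §17 (17.8) p. 98]
-/
noncomputable section

open Complex Real ComplexConjugate Finset

namespace Literature.NumberTheory.LFunctions.Zhang2022.Phi3Minus

open Literature.NumberTheory.LFunctions.Zhang2022
open Literature.NumberTheory.LFunctions.Zhang2022.Skeleton
open Literature.NumberTheory.LFunctions.Zhang2022.Typed.Section17
open Literature.NumberTheory.LFunctions.Zhang2022.MeanSquareMajorant (tau majorantConst)
open scoped LSeries.notation

/-! ## §1. Elementary eventual inequalities -/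

/-- `majorantConst(j²,2j) ≥ 0` (it dominates a nonnegative sum at `X = 2`). [folklore] -/
private theorem majorantConst_nonneg (j : ℕ) : 0 ≤ majorantConst (j ^ 2) (2 * j) := by
  have h := MeanSquareMajorant.sum_tau_sq_div_le j (le_refl 2)
  have h0 : 0 ≤ ∑ n ∈ Icc 1 2, tau j n ^ 2 / n := Finset.sum_nonneg fun n _ => by
    have := MeanSquareMajorant.tau_nonneg j n; positivity
  have hlog : 0 < Real.log (2 : ℕ) := by
    rw [Nat.cast_ofNat]; exact Real.log_pos (by norm_num)
  by_contra hneg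
  have : majorantConst (j ^ 2) (2 * j) * Real.log (2 : ℕ) ^ (j ^ 2) < 0 :=
    mul_neg_of_neg_of_pos (not_le.mp hneg) (pow_pos hlog _)
  exact absurd (h0.trans h) (not_le.mpr this)

/-- The polylogarithmic factor: if `1 ≤ Y`, `log Y ≤ L`, `1 ≤ L`, `j ≥ 1`, then
`majorantConst(j²,2j)(log Y)^{j²} + 1 + log Y ≤ (majorantConst(j²,2j) + 2)·L^{j²}`. [folklore] -/
private theorem polylog_le {j : ℕ} (hj : 1 ≤ j) {Y : ℕ} (hY : 1 ≤ Y) {Lb : ℝ} (hL : 1 ≤ Lb)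
    (hlog : Real.log Y ≤ Lb) :
    majorantConst (j ^ 2) (2 * j) * Real.log Y ^ (j ^ 2) + (1 + Real.log Y) ≤
      (majorantConst (j ^ 2) (2 * j) + 2) * Lb ^ (j ^ 2) := by
  have hlog0 : 0 ≤ Real.log Y := Real.log_nonneg (by exact_mod_cast hY)
  have hmC := majorantConst_nonneg j
  have h1 : Real.log Y ^ (j ^ 2) ≤ Lb ^ (j ^ 2) := pow_le_pow_left₀ hlog0 hlog _
  have hj2 : j ^ 2 ≠ 0 := pow_ne_zero 2 (by omega)
  have h2 : Lb ≤ Lb ^ (j ^ 2) := le_self_pow₀ hL hj2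
  have h3 : (1 : ℝ) ≤ Lb ^ (j ^ 2) := one_le_pow₀ hL
  nlinarith [mul_le_mul_of_nonneg_left h1 hmC]

/-- **`K𝓛^k ≤ εD` once `𝓛 ≥ max(1, |K|(k+1)!/ε)`** (`𝓛^{k+1} ≤ (k+1)!·e^{𝓛} = (k+1)!·D`). [folklore] -/
private theorem ell_pow_le_eps_mul (K : ℝ) (k : ℕ) {ε : ℝ} (hε : 0 < ε) {D : ℕ}
    (hℓ : max 1 (|K| * (k + 1).factorial / ε) ≤ ell D) : K * ell D ^ k ≤ ε * D := by
  have hℓ1 : 1 ≤ ell D := le_trans (le_max_left _ _) hℓ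
  have hℓ0 : 0 < ell D := by linarith
  have hD0 : (0 : ℝ) < D := by
    rcases Nat.eq_zero_or_pos D with h | h
    · exfalso; simp [ell, h] at hℓ0
    · exact_mod_cast h
  have hfac : (0 : ℝ) < (k + 1).factorial := by exact_mod_cast Nat.factorial_pos _
  -- `ℓ^{k+1} ≤ (k+1)!·D`
  have hpow : ell D ^ (k + 1) ≤ (k + 1).factorial * D := by
    have h := Real.pow_div_factorial_le_exp (ell D) hℓ0.le (k + 1)
    rw [ell, Real.exp_log hD0] at h
    rw [div_le_iff₀ hfac] at h
    rw [ell]; linarith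
  -- `|K|(k+1)! ≤ εℓ`
  have hK : |K| * (k + 1).factorial ≤ ε * ell D := by
    have := le_trans (le_max_right _ _) hℓ
    rwa [div_le_iff₀ hε, mul_comm (ell D)] at this
  calc K * ell D ^ k ≤ |K| * ell D ^ k := by
        exact mul_le_mul_of_nonneg_right (le_abs_self K) (pow_nonneg hℓ0.le _)
    _ = |K| * ell D ^ (k + 1) / ell D := by
        rw [pow_succ]; field_simp
    _ ≤ |K| * ((k + 1).factorial * D) / ell D := by gcongr
    _ = (|K| * (k + 1).factorial) * D / ell D := by ring
    _ ≤ (ε * ell D) * D / ell D := by gcongr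
    _ = ε * D := by field_simp

/-- `D ≤ P^{1/2}`, `D ≤ T²`, `D ≤ P` and `P^{5/2}·(1/3)^{𝓛₂²−2} ≤ D⁻¹` once `𝓛 ≥ 2`
(`D = e^{𝓛}`, `P = e^{𝓛⁹}`, `T = e^{𝓛^{1.1}}`, `𝓛₂² = 𝓛⁸⁰⁰`). [cite: Zhang2022LandauSiegel, §2 p.4–5] -/
private theorem D_le_scales {D : ℕ} (hℓ : 2 ≤ ell D) :
    (D : ℝ) ≤ bigP D ^ (1 / 2 : ℝ) ∧ (D : ℝ) ≤ bigT D ^ 2 ∧ (D : ℝ) ≤ bigP D ∧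
      bigP D ^ (5 / 2 : ℝ) * (1 / 3 : ℝ) ^ (ell2 D ^ 2 - 2) ≤ (D : ℝ)⁻¹ := by
  have hℓ1 : 1 ≤ ell D := by linarith
  have hℓ0 : 0 < ell D := by linarith
  have hD0 : (0 : ℝ) < D := by
    rcases Nat.eq_zero_or_pos D with h | h
    · exfalso; simp [ell, h] at hℓ0
    · exact_mod_cast h
  have hD : (D : ℝ) = Real.exp (ell D) := by rw [ell, Real.exp_log hD0]
  have hP : 0 < bigP D := Real.exp_pos _
  have h9 : ell D ≤ ell D ^ 9 := le_self_pow₀ hℓ1 (by norm_num)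
  have hPhalf : bigP D ^ (1 / 2 : ℝ) = Real.exp (ell D ^ 9 / 2) := by
    rw [bigP, ← Real.exp_mul]; ring_nf
  refine ⟨?_, ?_, ?_, ?_⟩
  · rw [hD, hPhalf, Real.exp_le_exp]
    have h8 : 2 * ell D ≤ ell D ^ 9 := by
      have : ell D ^ 9 = ell D * ell D ^ 8 := by ring
      nlinarith [one_le_pow₀ (M₀ := ℝ) hℓ1 (n := 8), show (2:ℝ) ^ 8 ≤ ell D ^ 8 from
        pow_le_pow_left₀ (by norm_num) hℓ 8]
    linarith
  · rw [hD, bigT, ← Real.exp_nat_mul, Real.exp_le_exp]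
    have : ell D ≤ ell D ^ (1.1 : ℝ) := by
      have := Real.rpow_le_rpow_of_exponent_le hℓ1 (show (1 : ℝ) ≤ 1.1 by norm_num)
      rwa [Real.rpow_one] at this
    push_cast; linarith
  · rw [hD, bigP, Real.exp_le_exp]; exact h9
  · -- `P^{5/2}(1/3)^{ℓ^{800}−2} ≤ e^{2.5ℓ⁹}·e^{−(ℓ^{800}−2)} ≤ e^{−ℓ}`
    have hℓ2sq : ell2 D ^ 2 = ell D ^ 800 := by rw [ell2]; ring
    have hexp1 : bigP D ^ (5 / 2 : ℝ) = Real.exp (5 / 2 * ell D ^ 9) := by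
      rw [bigP, ← Real.exp_mul]; ring_nf
    have h800 : 2 ≤ ell D ^ 800 := le_trans hℓ (le_self_pow₀ hℓ1 (by norm_num))
    have hthird : (1 / 3 : ℝ) ^ (ell2 D ^ 2 - 2) ≤ Real.exp (-(ell D ^ 800 - 2)) := by
      rw [hℓ2sq]
      have h13 : (1 / 3 : ℝ) ≤ Real.exp (-1) := by
        rw [Real.exp_neg, le_inv_comm₀ (by norm_num) (Real.exp_pos _)]
        have := Real.exp_one_lt_d9; norm_num; linarith
      calc (1 / 3 : ℝ) ^ (ell D ^ 800 - 2) ≤ Real.exp (-1) ^ (ell D ^ 800 - 2) :=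
            Real.rpow_le_rpow (by norm_num) h13 (by linarith)
        _ = Real.exp (-(ell D ^ 800 - 2)) := by rw [← Real.exp_mul]; ring_nf
    have hbig : 5 / 2 * ell D ^ 9 + -(ell D ^ 800 - 2) ≤ -ell D := by
      -- `ℓ^{800} ≥ ℓ^{10} = ℓ·ℓ⁹ ≥ 2ℓ⁹ ≥ ...`; use `ℓ^{800} ≥ ℓ^9·ℓ^2·...`
      have h12 : ell D ^ 12 ≤ ell D ^ 800 := pow_le_pow_right₀ hℓ1 (by norm_num)
      have e12 : ell D ^ 12 = ell D ^ 3 * ell D ^ 9 := by ring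
      have hℓ3 : (8 : ℝ) ≤ ell D ^ 3 := by
        have := pow_le_pow_left₀ (by norm_num : (0 : ℝ) ≤ 2) hℓ 3; norm_num at this; exact this
      have h99 : 0 ≤ ell D ^ 9 := by positivity
      have h8 : 8 * ell D ^ 9 ≤ ell D ^ 800 := by nlinarith
      have h9' : ell D ≤ ell D ^ 9 := h9
      have h29 : 2 ≤ ell D ^ 9 := le_trans hℓ h9
      linarith
    calc bigP D ^ (5 / 2 : ℝ) * (1 / 3 : ℝ) ^ (ell2 D ^ 2 - 2)
        ≤ Real.exp (5 / 2 * ell D ^ 9) * Real.exp (-(ell D ^ 800 - 2)) := by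
          rw [hexp1]; exact mul_le_mul_of_nonneg_left hthird (Real.exp_pos _).le
      _ = Real.exp (5 / 2 * ell D ^ 9 + -(ell D ^ 800 - 2)) := by rw [Real.exp_add]
      _ ≤ Real.exp (-ell D) := Real.exp_le_exp.mpr hbig
      _ = (D : ℝ)⁻¹ := by rw [hD, Real.exp_neg]

/-! ## §2. The `l = D⁴` boundary sum -/

section Boundary

variable (c' : ℝ) {D : ℕ} (χ : DirichletCharacter ℂ D)

/-- AM–GM with weight `d`: `2d·ab ≤ a² + d²b²`. [folklore] -/
private theorem two_mul_le_sq_add (a b d : ℝ) : 2 * d * (a * b) ≤ a ^ 2 + d ^ 2 * b ^ 2 := by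
  nlinarith [sq_nonneg (a - d * b)]

/-- **The boundary sum is `≪ |ν(D⁴)|·D⁻²·𝓛^{O(1)}`**: for `log D ≥ 2` and `X ≥ 2`,
`Σ_{1≤n≤X} |β(n)|·|ϱ*_≤(n) − ϱ*(n)|/n ≤ |ν(D⁴)|·(K²·majorantConst(36,12)(log X)³⁶ + majorantConst(4,4)(log X)⁴)/(2D²)`
(`β = (bχ)∗ν₁*`, `K = (1+|ι₂|)(|ι₃|+|ι₄|)`): only `n = D⁴k` contribute, with `|β(n)||κ̄₂(k)|/n ≤
(|β(n)|²/n + |κ̄₂(k)|²/k)/(2D²)`, and the two mean values are the tree's `sum_tau_sq_div_le`.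
[cite: Zhang2022LandauSiegel, §17 (17.8) p.98] -/
theorem boundary_sum_le (hD : 2 ≤ Real.log D) {X : ℕ} (hX : 2 ≤ X) :
    ∑ n ∈ Ico 1 (X + 1), ‖((fun n => bcoef D n * χ (n : ZMod D)) ⍟ nuOneStar c' χ) n‖ *
        ‖(trunc (D ^ 4) (nu χ) ⍟ kappa2bar c' D) n - varrho17 c' χ n‖ / n ≤
      ‖nu χ (D ^ 4)‖ * ((((1 + ‖iota2‖) * (‖iota3‖ + ‖iota4‖)) ^ 2 *
          majorantConst (6 ^ 2) (2 * 6) * Real.log X ^ (6 ^ 2) +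
        majorantConst (2 ^ 2) (2 * 2) * Real.log X ^ (2 ^ 2)) / (2 * (D : ℝ) ^ 2)) := by
  set K : ℝ := (1 + ‖iota2‖) * (‖iota3‖ + ‖iota4‖) with hK
  set β : ℕ → ℂ := (fun n => bcoef D n * χ (n : ZMod D)) ⍟ nuOneStar c' χ with hβ
  set S : Finset ℕ := Ico 1 (X + 1) with hS
  have hK0 : 0 ≤ K := by positivity
  have hD1 : (1 : ℝ) < D := by
    have h0 : 0 < Real.log D := by linarith
    by_contra h
    exact absurd (Real.log_nonpos (Nat.cast_nonneg D) (not_lt.mp h)) (not_le.mpr h0)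
  have hD0 : D ≠ 0 := by
    rintro rfl; norm_num at hD1
  have hDpos : (0 : ℝ) < D := by linarith
  have hD4 : 0 < D ^ 4 := pow_pos (Nat.pos_of_ne_zero hD0) 4
  set d : ℝ := (D : ℝ) ^ 2 with hd
  have hd0 : 0 < d := by positivity
  have hD4R : ((D ^ 4 : ℕ) : ℝ) = d ^ 2 := by rw [hd]; push_cast; ring
  -- pointwise: only multiples of `D⁴` contribute
  have hdiff : ∀ n, ‖(trunc (D ^ 4) (nu χ) ⍟ kappa2bar c' D) n - varrho17 c' χ n‖ =
      if D ^ 4 ∣ n then ‖nu χ (D ^ 4)‖ * ‖kappa2bar c' D (n / D ^ 4)‖ else 0 := by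
    intro n
    rw [varrhoLe_sub_varrho17 c' χ hD0 n]
    split_ifs
    · exact norm_mul _ _
    · exact norm_zero
  have hβb : ∀ n, n ≠ 0 → ‖β n‖ ≤ K * tau 6 n := fun n _ => norm_bchiConv_le_tau c' χ hD n
  have hκb : ∀ k, k ≠ 0 → ‖kappa2bar c' D k‖ ≤ tau 2 k := fun k _ => by
    rw [MeanSquareMajorant.tau_two_apply, kappa2bar, Complex.norm_conj]
    exact Phi3Eval.norm_kappa₂_le_card_divisors _ k
  -- termwise AM–GM bound
  have hterm : ∀ n ∈ S, ‖β n‖ * ‖(trunc (D ^ 4) (nu χ) ⍟ kappa2bar c' D) n - varrho17 c' χ n‖ / n ≤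
      ‖nu χ (D ^ 4)‖ * ((K ^ 2 * (tau 6 n ^ 2 / n) +
        (if D ^ 4 ∣ n then tau 2 (n / D ^ 4) ^ 2 / ((n / D ^ 4 : ℕ) : ℝ) else 0)) / (2 * d)) := by
    intro n hn
    have hn1 : 1 ≤ n := (Finset.mem_Ico.mp hn).1
    have hn0 : (0 : ℝ) < n := by exact_mod_cast hn1
    have hν0 : 0 ≤ ‖nu χ (D ^ 4)‖ := norm_nonneg _
    have ht6 : 0 ≤ K ^ 2 * (tau 6 n ^ 2 / n) := by
      have := MeanSquareMajorant.tau_nonneg 6 n; positivity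
    rw [hdiff n]
    split_ifs with hdvd
    · obtain ⟨k, hk⟩ := hdvd
      have hk0 : k ≠ 0 := by rintro rfl; simp at hk; omega
      have hkpos : (0 : ℝ) < k := by exact_mod_cast Nat.pos_of_ne_zero hk0
      have hnk : n / D ^ 4 = k := by rw [hk, Nat.mul_div_cancel_left _ hD4]
      have hnR : (n : ℝ) = d ^ 2 * k := by rw [hk]; push_cast; rw [hd]; ring
      rw [hnk]
      set a : ℝ := ‖β n‖ with ha
      set b : ℝ := ‖kappa2bar c' D k‖ with hb
      have ha0 : 0 ≤ a := norm_nonneg _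
      have hb0 : 0 ≤ b := norm_nonneg _
      have haK : a ≤ K * tau 6 n := hβb n (by omega)
      have hbτ : b ≤ tau 2 k := hκb k hk0
      -- `a b/(d²k) ≤ (a²/(d²k) + b²/k)/(2d)` and then the majorants
      have hamgm : a * (‖nu χ (D ^ 4)‖ * b) / (d ^ 2 * k) ≤
          ‖nu χ (D ^ 4)‖ * ((a ^ 2 / (d ^ 2 * k) + b ^ 2 / k) / (2 * d)) := by
        rw [show a * (‖nu χ (D ^ 4)‖ * b) / (d ^ 2 * k) = ‖nu χ (D ^ 4)‖ * (a * b / (d ^ 2 * k)) by ring]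
        refine mul_le_mul_of_nonneg_left ?_ hν0
        rw [div_le_div_iff₀ (by positivity) (by positivity)]
        have h := two_mul_le_sq_add a b d
        have : (a ^ 2 / (d ^ 2 * k) + b ^ 2 / k) * (d ^ 2 * k) = a ^ 2 + d ^ 2 * b ^ 2 := by
          field_simp
        nlinarith [this, hd0, hkpos]
      have hsq1 : a ^ 2 / (d ^ 2 * k) ≤ K ^ 2 * (tau 6 n ^ 2 / (d ^ 2 * k)) := by
        have h2 : a ^ 2 ≤ (K * tau 6 n) ^ 2 := pow_le_pow_left₀ ha0 haK 2
        calc a ^ 2 / (d ^ 2 * k) ≤ (K * tau 6 n) ^ 2 / (d ^ 2 * k) :=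
              div_le_div_of_nonneg_right h2 (by positivity)
          _ = K ^ 2 * (tau 6 n ^ 2 / (d ^ 2 * k)) := by ring
      have hsq2 : b ^ 2 / k ≤ tau 2 k ^ 2 / k :=
        div_le_div_of_nonneg_right (pow_le_pow_left₀ hb0 hbτ 2) hkpos.le
      rw [hnR]
      refine hamgm.trans ?_
      gcongr
    · rw [mul_zero, zero_div, add_zero]
      positivity
  -- sum the majorants
  have hsub : S ⊆ Icc 1 X := fun n hn => by
    rw [hS, Finset.mem_Ico] at hn; rw [Finset.mem_Icc]; omega
  have h6 := MeanSquareMajorant.sum_tau_sq_div_le 6 hX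
  have h2 := MeanSquareMajorant.sum_tau_sq_div_le 2 hX
  have hsum6 : ∑ n ∈ S, tau 6 n ^ 2 / n ≤ majorantConst (6 ^ 2) (2 * 6) * Real.log X ^ (6 ^ 2) :=
    (Finset.sum_le_sum_of_subset_of_nonneg hsub fun n _ _ => by
      have := MeanSquareMajorant.tau_nonneg 6 n; positivity).trans h6
  -- the `κ̄₂` part: reindex `n = D⁴k`
  have hsum2 : ∑ n ∈ S, (if D ^ 4 ∣ n then tau 2 (n / D ^ 4) ^ 2 / ((n / D ^ 4 : ℕ) : ℝ) else 0) ≤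
      majorantConst (2 ^ 2) (2 * 2) * Real.log X ^ (2 ^ 2) := by
    rw [← Finset.sum_filter]
    have hinj : Set.InjOn (fun n => n / D ^ 4) ↑(S.filter (fun n => D ^ 4 ∣ n)) := by
      intro x hx y hy hxy
      obtain ⟨-, hxd⟩ := Finset.mem_filter.mp hx
      obtain ⟨-, hyd⟩ := Finset.mem_filter.mp hy
      have := congrArg (fun m => D ^ 4 * m) hxy
      simp only at this
      rwa [Nat.mul_div_cancel' hxd, Nat.mul_div_cancel' hyd] at this
    rw [← Finset.sum_image (g := fun n => n / D ^ 4) (f := fun k => tau 2 k ^ 2 / (k : ℝ)) hinj]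
    refine (Finset.sum_le_sum_of_subset_of_nonneg ?_ fun k _ _ => by
      have := MeanSquareMajorant.tau_nonneg 2 k; positivity).trans h2
    intro k hk
    obtain ⟨n, hn, rfl⟩ := Finset.mem_image.mp hk
    obtain ⟨hnS, hdvd⟩ := Finset.mem_filter.mp hn
    rw [hS, Finset.mem_Ico] at hnS
    rw [Finset.mem_Icc]
    constructor
    · exact Nat.div_pos (Nat.le_of_dvd (by omega) hdvd) hD4
    · exact le_trans (Nat.div_le_self _ _) (by omega)
  calc ∑ n ∈ S, ‖β n‖ * ‖(trunc (D ^ 4) (nu χ) ⍟ kappa2bar c' D) n - varrho17 c' χ n‖ / n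
      ≤ ∑ n ∈ S, ‖nu χ (D ^ 4)‖ * ((K ^ 2 * (tau 6 n ^ 2 / n) +
          (if D ^ 4 ∣ n then tau 2 (n / D ^ 4) ^ 2 / ((n / D ^ 4 : ℕ) : ℝ) else 0)) / (2 * d)) :=
        Finset.sum_le_sum hterm
    _ = ‖nu χ (D ^ 4)‖ * ((K ^ 2 * ∑ n ∈ S, tau 6 n ^ 2 / n +
          ∑ n ∈ S, (if D ^ 4 ∣ n then tau 2 (n / D ^ 4) ^ 2 / ((n / D ^ 4 : ℕ) : ℝ) else 0)) /
            (2 * d)) := by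
        rw [← Finset.mul_sum, ← Finset.sum_div, Finset.sum_add_distrib, Finset.mul_sum]
    _ ≤ ‖nu χ (D ^ 4)‖ * ((K ^ 2 * (majorantConst (6 ^ 2) (2 * 6) * Real.log X ^ (6 ^ 2)) +
          majorantConst (2 ^ 2) (2 * 2) * Real.log X ^ (2 ^ 2)) / (2 * d)) := by
        gcongr
    _ = _ := by rw [hd]; ring

end Boundary

/-! ## §3. Every error term is `≤ p·cℓ^{468}/D` -/

section Reduction

variable (c' : ℝ) {D : ℕ} [NeZero D] (χ : DirichletCharacter ℂ D)

omit [NeZero D] in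
set_option maxHeartbeats 1600000 in
/-- **The right side of `norm_Phi3minus_sub_main_le` is `≤ p·c·𝓛⁴⁶⁸/D`** with an ABSOLUTE `c`
(depending only on the divisor-bound constants `Cρ`, `Cd`, on `Σm^{−5/4}`, on `K = (1+|ι₂|)(|ι₃|+|ι₄|)`
and on the `majorantConst`s), for `𝓛 ≥ 5¹⁰` and `p` in the window (a long but elementary
bookkeeping proof, hence the raised heartbeat budget). [cite: Zhang2022LandauSiegel, §17 (17.8) p.98] -/
theorem main_rhs_le (hℓ : (5 : ℝ) ^ (10 : ℕ) ≤ ell D) {p : ℕ} (hp : p ∈ primeWindow D)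
    {Cρ : ℝ} (hCρ0 : 0 ≤ Cρ)
    (hCρ : ∀ m : ℕ, ‖(trunc (D ^ 4) (nu χ) ⍟ kappa2bar c' D) m‖ ≤ Cρ * (m : ℝ) ^ (1 / 4 : ℝ))
    {Cd : ℝ} (hCd1 : 1 ≤ Cd) (hCd : ∀ n : ℕ, (n.divisors.card : ℝ) ≤ Cd * (n : ℝ) ^ (1 / 4 : ℝ)) :
    (p : ℝ) * (∑' m : ℕ, ‖LSeries.term (trunc (D ^ 4) (nu χ) ⍟ kappa2bar c' D) (3 / 2 : ℂ) m‖) *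
          (∑ n ∈ Finset.Ico 1 (⌊bigP D / bigT D ^ 2⌋₊ + 1),
            ‖((fun n => bcoef D n * χ (n : ZMod D)) ⍟ nuOneStar c' χ) n‖ * Real.sqrt n) *
          Real.exp ((1 - ell1 D ^ 2) / (4 * ell2 D ^ 2)) +
      ((∑ m ∈ Finset.range (3 * ⌊bigP D / bigT D ^ 2⌋₊),
          ‖(trunc (D ^ 4) (nu χ) ⍟ kappa2bar c' D) m‖ * (m : ℝ) ^ (-(1 / 2 : ℝ))) *
          (∑ n ∈ Finset.Ico 1 (⌊bigP D / bigT D ^ 2⌋₊ + 1),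
            ‖((fun n => bcoef D n * χ (n : ZMod D)) ⍟ nuOneStar c' χ) n‖ * (n : ℝ) ^ (-(1 / 2 : ℝ))) +
        (∑' m : ℕ, ‖LSeries.term (trunc (D ^ 4) (nu χ) ⍟ kappa2bar c' D) (3 / 2 : ℂ) m‖) *
          (∑ n ∈ Finset.Ico 1 (⌊bigP D / bigT D ^ 2⌋₊ + 1),
            ‖((fun n => bcoef D n * χ (n : ZMod D)) ⍟ nuOneStar c' χ) n‖ * (n : ℝ) ^ (3 / 2 : ℝ)) *
          ((1 + ((p : ℝ) - 1)) * (1 / 3 : ℝ) ^ (ell2 D ^ 2 - 2))) +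
      2 * (∑ n ∈ Finset.Ico 1 (⌊bigP D / bigT D ^ 2⌋₊ + 1),
          ‖(trunc (D ^ 4) (nu χ) ⍟ kappa2bar c' D) n‖ *
            ‖((fun n => bcoef D n * χ (n : ZMod D)) ⍟ nuOneStar c' χ) n‖ / n) +
      ((p : ℝ) + 2) * ‖∑ n ∈ Finset.Ico 1 (⌊bigP D / bigT D ^ 2⌋₊ + 1),
          ((fun n => bcoef D n * χ (n : ZMod D)) ⍟ nuOneStar c' χ) n *
            ((trunc (D ^ 4) (nu χ) ⍟ kappa2bar c' D) n - varrho17 c' χ n) / (n : ℂ)‖ ≤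
      (p : ℝ) * ((2 * (Cρ * (∑' m : ℕ, (m : ℝ) ^ (-(5 / 4 : ℝ)))) * ((1 + ‖iota2‖) * (‖iota3‖ + ‖iota4‖)) *
            (majorantConst (6 ^ 2) (2 * 6) + 2) +
          3 * ((1 + ‖iota2‖) * (‖iota3‖ + ‖iota4‖)) * ((majorantConst (4 ^ 2) (2 * 4) + 2) * 2 ^ 16) *
            (majorantConst (6 ^ 2) (2 * 6) + 2) +
          2 * ((1 + ‖iota2‖) * (‖iota3‖ + ‖iota4‖)) *
            (majorantConst (4 ^ 2) (2 * 4) + majorantConst (6 ^ 2) (2 * 6)) +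
          Cd * (((1 + ‖iota2‖) * (‖iota3‖ + ‖iota4‖)) ^ 2 * majorantConst (6 ^ 2) (2 * 6) +
            majorantConst (2 ^ 2) (2 * 2))) * ell D ^ 468) / D := by
  obtain ⟨hX2, h3X, hL2, hD2⟩ := window_facts hℓ hp
  set X : ℕ := ⌊bigP D / bigT D ^ 2⌋₊ with hXdef
  set S : Finset ℕ := Finset.Ico 1 (X + 1) with hSdef
  set ρ : ℕ → ℂ := trunc (D ^ 4) (nu χ) ⍟ kappa2bar c' D with hρ
  set β : ℕ → ℂ := (fun n => bcoef D n * χ (n : ZMod D)) ⍟ nuOneStar c' χ with hβ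
  set K : ℝ := (1 + ‖iota2‖) * (‖iota3‖ + ‖iota4‖) with hK
  set Z : ℝ := ∑' m : ℕ, (m : ℝ) ^ (-(5 / 4 : ℝ)) with hZ
  set m6 : ℝ := majorantConst (6 ^ 2) (2 * 6) with hm6
  set m4 : ℝ := majorantConst (4 ^ 2) (2 * 4) with hm4
  set m2 : ℝ := majorantConst (2 ^ 2) (2 * 2) with hm2
  set A₀ : ℝ := ∑' m : ℕ, ‖LSeries.term ρ (3 / 2 : ℂ) m‖ with hA₀
  -- basic positivity / window facts
  have hℓ1 : 1 ≤ ell D := le_trans (by norm_num) hℓ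
  have hℓ2 : 2 ≤ ell D := le_trans (by norm_num) hℓ
  have hℓ12 : 12 ≤ ell D := le_trans (by norm_num) hℓ
  have hlogD : 2 ≤ Real.log D := hℓ2
  have hK0 : 0 ≤ K := by positivity
  have hZ0 : 0 ≤ Z := tsum_nonneg fun m => by positivity
  have hm6 : 0 ≤ m6 := majorantConst_nonneg 6
  have hm4 : 0 ≤ m4 := majorantConst_nonneg 4
  have hm2 : 0 ≤ m2 := majorantConst_nonneg 2
  have hP0 : 0 < bigP D := Real.exp_pos _
  have hT0 : 0 < bigT D := Real.exp_pos _
  have hp0 : (0 : ℝ) < p := pos_of_mem_primeWindow hp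
  have hPp : bigP D < p := bigP_lt_of_mem_primeWindow hp
  obtain ⟨hDPh, hDT2, hDP, hfar⟩ := D_le_scales hℓ2
  have hDpos : (0 : ℝ) < D := by exact_mod_cast (show 0 < D by omega)
  have hDp : (D : ℝ) ≤ p := hDP.trans hPp.le
  have hXR : (X : ℝ) ≤ bigP D / bigT D ^ 2 := Nat.floor_le (by positivity)
  have hT1 : 1 ≤ bigT D ^ 2 := one_le_pow₀ (Real.one_le_exp (by unfold ell; positivity))
  have hXP : (X : ℝ) ≤ bigP D := hXR.trans (div_le_self hP0.le hT1)
  have hX0 : (0 : ℝ) < X := by exact_mod_cast (show 0 < X by omega)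
  have hX1 : (1 : ℝ) ≤ X := by exact_mod_cast (show 1 ≤ X by omega)
  -- logarithms: `log X ≤ ℓ⁹`, `log 3X ≤ 2ℓ⁹`
  set Lb : ℝ := ell D ^ 9 with hLb
  have hLb1 : 1 ≤ Lb := one_le_pow₀ hℓ1
  have hlogX : Real.log X ≤ Lb := by
    calc Real.log X ≤ Real.log (bigP D) := Real.log_le_log hX0 hXP
      _ = Lb := by rw [bigP, Real.log_exp]
  have hlog3X : Real.log ((3 * X : ℕ) : ℝ) ≤ 2 * Lb := by
    have h3 : Real.log 3 ≤ Lb := by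
      have : Real.log 3 ≤ 2 := by
        rw [Real.log_le_iff_le_exp (by norm_num)]
        have := Real.add_one_le_exp (2 : ℝ); nlinarith [Real.exp_pos (2:ℝ), Real.add_one_le_exp (1:ℝ), Real.exp_one_gt_d9]
      exact this.trans (le_trans hℓ2 (le_self_pow₀ hℓ1 (by norm_num)))
    push_cast
    rw [Real.log_mul (by norm_num) hX0.ne']
    linarith
  have h2Lb1 : 1 ≤ 2 * Lb := by linarith
  -- polylog factors
  have hPL6 : m6 * Real.log X ^ (6 ^ 2) + (1 + Real.log X) ≤ (m6 + 2) * Lb ^ (6 ^ 2) :=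
    polylog_le (by norm_num) (by omega) hLb1 hlogX
  have hPL4 : m4 * Real.log ((3 * X : ℕ) : ℝ) ^ (4 ^ 2) + (1 + Real.log ((3 * X : ℕ) : ℝ)) ≤
      (m4 + 2) * (2 * Lb) ^ (4 ^ 2) :=
    polylog_le (by norm_num) (by omega) h2Lb1 hlog3X
  have hPL60 : 0 ≤ (m6 + 2) * Lb ^ (6 ^ 2) := by positivity
  -- coefficient majorants
  have hβb : ∀ n, n ≠ 0 → ‖β n‖ ≤ K * tau 6 n := fun n _ => norm_bchiConv_le_tau c' χ hlogD n
  have hρb : ∀ n, n ≠ 0 → ‖ρ n‖ ≤ 1 * 1 * tau 4 n := fun n _ => norm_varrhoLe_le_tau c' χ n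
  have hρ0 : ρ 0 = 0 := by rw [hρ]; exact LSeries.convolution_map_zero _ _
  -- (a) `A₀ ≤ Cρ Z`
  have hA : A₀ ≤ Cρ * Z := (tsum_norm_term_le_of_rpow hCρ).2
  have hA0 : 0 ≤ A₀ := tsum_nonneg fun _ => norm_nonneg _
  -- (b) the `β`-sums
  have hB := fun (e : ℝ) (he : -1 ≤ e) =>
    sum_norm_mul_rpow_le_of_tau hK0 hβb he (le_refl (X + 1)) hX2
  have hBhalf : ∑ n ∈ S, ‖β n‖ * Real.sqrt n ≤ K * bigP D ^ (3 / 2 : ℝ) * ((m6 + 2) * Lb ^ (6 ^ 2)) := by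
    have h := hB (1 / 2) (by norm_num)
    have e1 : ∑ n ∈ S, ‖β n‖ * Real.sqrt n = ∑ n ∈ S, ‖β n‖ * (n : ℝ) ^ (1 / 2 : ℝ) :=
      Finset.sum_congr rfl fun n _ => by rw [Real.sqrt_eq_rpow]
    rw [e1]
    refine h.trans ?_
    have hXp : (X : ℝ) ^ ((1 / 2 : ℝ) + 1) ≤ bigP D ^ (3 / 2 : ℝ) := by
      rw [show (1 / 2 : ℝ) + 1 = 3 / 2 by norm_num]
      exact Real.rpow_le_rpow hX0.le hXP (by norm_num)
    gcongr
  have hBneg : ∑ n ∈ S, ‖β n‖ * (n : ℝ) ^ (-(1 / 2 : ℝ)) ≤ K * (X : ℝ) ^ (1 / 2 : ℝ) * ((m6 + 2) * Lb ^ (6 ^ 2)) := by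
    have h := hB (-(1 / 2)) (by norm_num)
    rw [show (-(1 / 2 : ℝ)) + 1 = 1 / 2 by norm_num] at h
    refine h.trans ?_
    gcongr
  have hB3 : ∑ n ∈ S, ‖β n‖ * (n : ℝ) ^ (3 / 2 : ℝ) ≤ K * bigP D ^ (5 / 2 : ℝ) * ((m6 + 2) * Lb ^ (6 ^ 2)) := by
    have h := hB (3 / 2) (by norm_num)
    refine h.trans ?_
    have hXp : (X : ℝ) ^ ((3 / 2 : ℝ) + 1) ≤ bigP D ^ (5 / 2 : ℝ) := by
      rw [show (3 / 2 : ℝ) + 1 = 5 / 2 by norm_num]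
      exact Real.rpow_le_rpow hX0.le hXP (by norm_num)
    gcongr
  -- (e) the near `ρ`-sum
  have hRn : ∑ m ∈ Finset.range (3 * X), ‖ρ m‖ * (m : ℝ) ^ (-(1 / 2 : ℝ)) ≤
      1 * 1 * ((3 * X : ℕ) : ℝ) ^ (1 / 2 : ℝ) * ((m4 + 2) * (2 * Lb) ^ (4 ^ 2)) := by
    have h := sum_range_norm_mul_rpow_le_of_tau hρ0 (by norm_num) hρb (show -1 ≤ (-(1 / 2 : ℝ)) by norm_num)
      (show 3 * X ≤ 3 * X + 1 by omega) (show 2 ≤ 3 * X by omega)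
    rw [show (-(1 / 2 : ℝ)) + 1 = 1 / 2 by norm_num] at h
    refine h.trans ?_
    gcongr
  -- (f) the diagonal sum
  have hDG : ∑ n ∈ S, ‖ρ n‖ * ‖β n‖ / n ≤ 1 * 1 * K * (m4 * Lb ^ (6 ^ 2) + m6 * Lb ^ (6 ^ 2)) := by
    have h := sum_norm_mul_norm_div_le_of_tau (by norm_num) hK0 hρb hβb (le_refl (X + 1)) hX2
    refine h.trans ?_
    have hlog0 : 0 ≤ Real.log X := Real.log_nonneg hX1
    have h16 : Real.log X ^ (4 ^ 2) ≤ Lb ^ (6 ^ 2) :=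
      (pow_le_pow_left₀ hlog0 hlogX _).trans (pow_le_pow_right₀ hLb1 (by norm_num))
    have h36 : Real.log X ^ (6 ^ 2) ≤ Lb ^ (6 ^ 2) := pow_le_pow_left₀ hlog0 hlogX _
    gcongr
  -- (g) the boundary sum
  have hBD : ‖∑ n ∈ S, β n * (ρ n - varrho17 c' χ n) / (n : ℂ)‖ ≤
      Cd * D * ((K ^ 2 * m6 * Lb ^ (6 ^ 2) + m2 * Lb ^ (6 ^ 2)) / (2 * (D : ℝ) ^ 2)) := by
    have h := boundary_sum_le c' χ hlogD hX2
    have hn : ‖∑ n ∈ S, β n * (ρ n - varrho17 c' χ n) / (n : ℂ)‖ ≤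
        ∑ n ∈ S, ‖β n‖ * ‖ρ n - varrho17 c' χ n‖ / n := by
      refine (norm_sum_le _ _).trans (le_of_eq (Finset.sum_congr rfl fun n _ => ?_))
      rw [norm_div, norm_mul, Complex.norm_natCast]
    refine hn.trans (h.trans ?_)
    have hν : ‖nu χ (D ^ 4)‖ ≤ Cd * D := by
      refine (Literature.NumberTheory.LFunctions.norm_divisorSumChar_le χ (D ^ 4)).trans ?_
      refine (hCd (D ^ 4)).trans (le_of_eq ?_)
      congr 1
      push_cast
      rw [show ((D : ℝ) ^ 4) = (D : ℝ) ^ ((4 : ℕ) : ℝ) by rw [Real.rpow_natCast], ← Real.rpow_mul hDpos.le]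
      norm_num
    have hlog0 : 0 ≤ Real.log X := Real.log_nonneg hX1
    have h4 : Real.log X ^ (2 ^ 2) ≤ Lb ^ (6 ^ 2) :=
      (pow_le_pow_left₀ hlog0 hlogX _).trans (pow_le_pow_right₀ hLb1 (by norm_num))
    have h36 : Real.log X ^ (6 ^ 2) ≤ Lb ^ (6 ^ 2) := pow_le_pow_left₀ hlog0 hlogX _
    have hν0 : 0 ≤ ‖nu χ (D ^ 4)‖ := norm_nonneg _
    gcongr
  -- scale facts
  have hE : Real.exp ((1 - ell1 D ^ 2) / (4 * ell2 D ^ 2)) ≤ (bigP D ^ 2)⁻¹ :=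
    exp_segment_error_le_P_inv_sq hℓ12
  have hPE : bigP D ^ (3 / 2 : ℝ) * (bigP D ^ 2)⁻¹ ≤ (D : ℝ)⁻¹ := by
    have e : bigP D ^ (3 / 2 : ℝ) * (bigP D ^ 2)⁻¹ = (bigP D ^ (1 / 2 : ℝ))⁻¹ := by
      rw [← Real.rpow_natCast, ← Real.rpow_neg hP0.le, ← Real.rpow_add hP0, ← Real.rpow_neg hP0.le]
      norm_num
    rw [e]
    exact inv_anti₀ hDpos hDPh
  have h3X : ((3 * X : ℕ) : ℝ) ^ (1 / 2 : ℝ) * (X : ℝ) ^ (1 / 2 : ℝ) ≤ 3 * (bigP D / (D : ℝ)) := by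
    have h1 : (X : ℝ) ^ (1 / 2 : ℝ) ≤ ((3 * X : ℕ) : ℝ) ^ (1 / 2 : ℝ) :=
      Real.rpow_le_rpow hX0.le (by push_cast; linarith) (by norm_num)
    have h33 : (0 : ℝ) ≤ ((3 * X : ℕ) : ℝ) := by positivity
    calc ((3 * X : ℕ) : ℝ) ^ (1 / 2 : ℝ) * (X : ℝ) ^ (1 / 2 : ℝ)
        ≤ ((3 * X : ℕ) : ℝ) ^ (1 / 2 : ℝ) * ((3 * X : ℕ) : ℝ) ^ (1 / 2 : ℝ) :=
          mul_le_mul_of_nonneg_left h1 (by positivity)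
      _ = ((3 * X : ℕ) : ℝ) := by rw [← Real.rpow_add' h33 (by norm_num)]; norm_num
      _ ≤ 3 * (bigP D / bigT D ^ 2) := by push_cast; linarith
      _ ≤ 3 * (bigP D / (D : ℝ)) := by gcongr
  -- now the five pieces, each `≤ p·(coeff·Lb^36-ish)/D`
  set PL6 : ℝ := (m6 + 2) * Lb ^ (6 ^ 2) with hPL6def
  set PL4 : ℝ := (m4 + 2) * (2 * Lb) ^ (4 ^ 2) with hPL4def
  have hPL40 : 0 ≤ PL4 := by positivity
  -- polynomial degrees: `Lb^36 = ℓ^324 ≤ ℓ^468`, `PL4·PL6 = (m4+2)2^16(m6+2)·ℓ^468`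
  have hℓ468 : Lb ^ (6 ^ 2) ≤ ell D ^ 468 := by
    rw [hLb, ← pow_mul]; exact pow_le_pow_right₀ hℓ1 (by norm_num)
  have hPL6' : PL6 ≤ (m6 + 2) * ell D ^ 468 := by
    rw [hPL6def]; exact mul_le_mul_of_nonneg_left hℓ468 (by positivity)
  have hPL46 : PL4 * PL6 = ((m4 + 2) * 2 ^ 16) * (m6 + 2) * ell D ^ 468 := by
    rw [hPL4def, hPL6def, hLb, mul_pow, ← pow_mul, ← pow_mul]
    have : ell D ^ (9 * 4 ^ 2) * ell D ^ (9 * 6 ^ 2) = ell D ^ 468 := by rw [← pow_add]; norm_num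
    calc (m4 + 2) * ((2 : ℝ) ^ (4 ^ 2) * ell D ^ (9 * 4 ^ 2)) * ((m6 + 2) * ell D ^ (9 * 6 ^ 2))
        = (m4 + 2) * 2 ^ (4 ^ 2) * (m6 + 2) * (ell D ^ (9 * 4 ^ 2) * ell D ^ (9 * 6 ^ 2)) := by ring
      _ = _ := by rw [this]; norm_num
  -- freeze the transcendental atoms so that `ring`/`gcongr` see opaque real numbers
  set r3 : ℝ := ((3 * X : ℕ) : ℝ) ^ (1 / 2 : ℝ) with hr3
  set rX : ℝ := (X : ℝ) ^ (1 / 2 : ℝ) with hrX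
  set P32 : ℝ := bigP D ^ (3 / 2 : ℝ) with hP32
  set P52 : ℝ := bigP D ^ (5 / 2 : ℝ) with hP52
  set θ : ℝ := (1 / 3 : ℝ) ^ (ell2 D ^ 2 - 2) with hθ
  set Eg : ℝ := Real.exp ((1 - ell1 D ^ 2) / (4 * ell2 D ^ 2)) with hEg
  have hθ0 : 0 ≤ θ := by rw [hθ]; positivity
  have hEg0 : 0 ≤ Eg := by rw [hEg]; positivity
  have hr30 : 0 ≤ r3 := by rw [hr3]; positivity
  have hP320 : 0 ≤ P32 := by rw [hP32]; positivity
  clear_value r3 rX P32 P52 θ Eg PL6 PL4 Lb A₀ m6 m4 m2 Z K β ρ S X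
  have hE1 : (p : ℝ) * A₀ * (∑ n ∈ S, ‖β n‖ * Real.sqrt n) * Eg ≤ (p : ℝ) * (Cρ * Z * K * PL6) / D := by
    have hB0 : 0 ≤ ∑ n ∈ S, ‖β n‖ * Real.sqrt n := Finset.sum_nonneg fun _ _ => by positivity
    calc (p : ℝ) * A₀ * (∑ n ∈ S, ‖β n‖ * Real.sqrt n) * Eg
        ≤ (p : ℝ) * (Cρ * Z) * (K * P32 * PL6) * (bigP D ^ 2)⁻¹ := by
          gcongr
      _ = (p : ℝ) * (Cρ * Z * K * PL6) * (P32 * (bigP D ^ 2)⁻¹) := by ring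
      _ ≤ (p : ℝ) * (Cρ * Z * K * PL6) * (D : ℝ)⁻¹ := by gcongr
      _ = (p : ℝ) * (Cρ * Z * K * PL6) / D := by rw [div_eq_mul_inv]
  have hE2 : (∑ m ∈ Finset.range (3 * X), ‖ρ m‖ * (m : ℝ) ^ (-(1 / 2 : ℝ))) *
      (∑ n ∈ S, ‖β n‖ * (n : ℝ) ^ (-(1 / 2 : ℝ))) ≤ (p : ℝ) * (3 * K * PL4 * PL6) / D := by
    have hR0 : 0 ≤ ∑ m ∈ Finset.range (3 * X), ‖ρ m‖ * (m : ℝ) ^ (-(1 / 2 : ℝ)) :=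
      Finset.sum_nonneg fun _ _ => by positivity
    calc (∑ m ∈ Finset.range (3 * X), ‖ρ m‖ * (m : ℝ) ^ (-(1 / 2 : ℝ))) *
          (∑ n ∈ S, ‖β n‖ * (n : ℝ) ^ (-(1 / 2 : ℝ)))
        ≤ (1 * 1 * r3 * PL4) * (K * rX * PL6) :=
          mul_le_mul hRn hBneg (Finset.sum_nonneg fun _ _ => by positivity) (by positivity)
      _ = (r3 * rX) * (K * PL4 * PL6) := by ring
      _ ≤ (3 * (bigP D / (D : ℝ))) * (K * PL4 * PL6) := by gcongr
      _ = bigP D * (3 * K * PL4 * PL6) / D := by ring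
      _ ≤ (p : ℝ) * (3 * K * PL4 * PL6) / D := by gcongr
  have hE3 : A₀ * (∑ n ∈ S, ‖β n‖ * (n : ℝ) ^ (3 / 2 : ℝ)) * ((1 + ((p : ℝ) - 1)) * θ)
      ≤ (p : ℝ) * (Cρ * Z * K * PL6) / D := by
    calc A₀ * (∑ n ∈ S, ‖β n‖ * (n : ℝ) ^ (3 / 2 : ℝ)) * ((1 + ((p : ℝ) - 1)) * θ)
        ≤ (Cρ * Z) * (K * P52 * PL6) * ((p : ℝ) * θ) := by
          have : (1 + ((p : ℝ) - 1)) = p := by ring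
          rw [this]
          gcongr
      _ = (p : ℝ) * (Cρ * Z * K * PL6) * (P52 * θ) := by ring
      _ ≤ (p : ℝ) * (Cρ * Z * K * PL6) * (D : ℝ)⁻¹ := by gcongr
      _ = (p : ℝ) * (Cρ * Z * K * PL6) / D := by rw [div_eq_mul_inv]
  have hE4 : 2 * (∑ n ∈ S, ‖ρ n‖ * ‖β n‖ / n) ≤ (p : ℝ) * (2 * K * (m4 + m6) * Lb ^ (6 ^ 2)) / D := by
    rw [le_div_iff₀ hDpos]
    calc 2 * (∑ n ∈ S, ‖ρ n‖ * ‖β n‖ / n) * D ≤ 2 * (1 * 1 * K * (m4 * Lb ^ (6 ^ 2) + m6 * Lb ^ (6 ^ 2))) * p := by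
          gcongr
      _ = (p : ℝ) * (2 * K * (m4 + m6) * Lb ^ (6 ^ 2)) := by ring
  have hE5 : ((p : ℝ) + 2) * ‖∑ n ∈ S, β n * (ρ n - varrho17 c' χ n) / (n : ℂ)‖ ≤
      (p : ℝ) * (Cd * (K ^ 2 * m6 + m2) * Lb ^ (6 ^ 2)) / D := by
    have hp2 : (p : ℝ) + 2 ≤ 2 * p := by
      have : (2 : ℝ) ≤ p := by exact_mod_cast (prime_of_mem_primeWindow' hp).two_le
      linarith
    calc ((p : ℝ) + 2) * ‖∑ n ∈ S, β n * (ρ n - varrho17 c' χ n) / (n : ℂ)‖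
        ≤ (2 * p) * (Cd * D * ((K ^ 2 * m6 * Lb ^ (6 ^ 2) + m2 * Lb ^ (6 ^ 2)) / (2 * (D : ℝ) ^ 2))) :=
          mul_le_mul hp2 hBD (norm_nonneg _) (by positivity)
      _ = (p : ℝ) * (Cd * (K ^ 2 * m6 + m2) * Lb ^ (6 ^ 2)) / D := by
          field_simp
  -- add up
  have hpD : 0 ≤ (p : ℝ) / D := by positivity
  have hc1 : 0 ≤ Cρ * Z * K := by positivity
  have hCd0 : 0 ≤ Cd := by linarith
  have hE1' : (p : ℝ) * (Cρ * Z * K * PL6) / D ≤ (p : ℝ) * (Cρ * Z * K * (m6 + 2) * ell D ^ 468) / D := by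
    have : Cρ * Z * K * PL6 ≤ Cρ * Z * K * (m6 + 2) * ell D ^ 468 := by
      calc Cρ * Z * K * PL6 ≤ Cρ * Z * K * ((m6 + 2) * ell D ^ 468) := mul_le_mul_of_nonneg_left hPL6' hc1
        _ = _ := by ring
    gcongr
  have hE2' : (p : ℝ) * (3 * K * PL4 * PL6) / D =
      (p : ℝ) * (3 * K * ((m4 + 2) * 2 ^ 16) * (m6 + 2) * ell D ^ 468) / D := by
    rw [show 3 * K * PL4 * PL6 = 3 * K * (PL4 * PL6) by ring, hPL46]; ring
  have hE4' : (p : ℝ) * (2 * K * (m4 + m6) * Lb ^ (6 ^ 2)) / D ≤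
      (p : ℝ) * (2 * K * (m4 + m6) * ell D ^ 468) / D := by
    have h0 : 0 ≤ 2 * K * (m4 + m6) := by positivity
    gcongr
  have hE5' : (p : ℝ) * (Cd * (K ^ 2 * m6 + m2) * Lb ^ (6 ^ 2)) / D ≤
      (p : ℝ) * (Cd * (K ^ 2 * m6 + m2) * ell D ^ 468) / D := by
    have h0 : 0 ≤ Cd * (K ^ 2 * m6 + m2) := by positivity
    gcongr
  have hsum := add_le_add (add_le_add (add_le_add (hE1.trans hE1') (add_le_add (hE2.trans_eq hE2')
    (hE3.trans hE1'))) (hE4.trans hE4')) (hE5.trans hE5')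
  refine hsum.trans (le_of_eq ?_)
  ring

end Reduction

end Literature.NumberTheory.LFunctions.Zhang2022.Phi3Minus

/-! ## §4. (17.8)χ holds -/

namespace Literature.NumberTheory.LFunctions.Zhang2022.Typed.Section17

open Literature.NumberTheory.LFunctions.Zhang2022
open Literature.NumberTheory.LFunctions.Zhang2022.Skeleton
open Literature.NumberTheory.LFunctions.Zhang2022.MeanSquareMajorant (majorantConst)
open scoped LSeries.notation

/-- **(17.8) in the χ-twisted reading of record RT16-int-1 HOLDS, unconditionally**: for every `c′`
and every `ε > 0`, for all large `D` (real primitive `χ (mod D)`) and every prime `p ∈ (P, P(1+η)]`,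
`|Φ₃⁻(p) − pΣ_n ((bχ)∗ν₁*)(n)ϱ*(n)/n| ≤ εp` (§17 p. 98: "In a way similar to the proof of (17.3) we
deduce that `Φ₃⁻(p) = pΣ_n (b∗ν₁*)(n)ϱ*(n)/n + o(p)`"). Assumption (A) is not used. The whole chain:
reflection of `𝔍(−1)` and term-by-term integration (`Section17Phi3minusLine`), the sum over
`Σ*_{ψ (mod p)}` with the refined off-diagonal estimate (`…OffDiag`), divisor-sum sizes (`…Sizes`),
support `n < PT⁻²` and the `l = D⁴` boundary term (`Section17Eq178ChiSupport`), the explicit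
inequality (`…Main`), and the `o(p)` bookkeeping above. [cite: Zhang2022LandauSiegel, §17 (17.8) p.98] -/
theorem eq17_8Chi_holds (c' : ℝ) : Eq17_8Chi c' := by
  intro ε hε
  obtain ⟨Cρ, hCρ0, hCρ⟩ := Phi3Minus.exists_norm_varrhoLe_le_rpow
  obtain ⟨Cd, hCd1, hCd⟩ :=
    Literature.NumberTheory.Sieve.exists_card_divisors_le_mul_rpow' (by norm_num : (0 : ℝ) < 1 / 4)
  set c : ℝ := 2 * (Cρ * (∑' m : ℕ, (m : ℝ) ^ (-(5 / 4 : ℝ)))) * ((1 + ‖iota2‖) * (‖iota3‖ + ‖iota4‖)) *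
        (majorantConst (6 ^ 2) (2 * 6) + 2) +
      3 * ((1 + ‖iota2‖) * (‖iota3‖ + ‖iota4‖)) * ((majorantConst (4 ^ 2) (2 * 4) + 2) * 2 ^ 16) *
        (majorantConst (6 ^ 2) (2 * 6) + 2) +
      2 * ((1 + ‖iota2‖) * (‖iota3‖ + ‖iota4‖)) *
        (majorantConst (4 ^ 2) (2 * 4) + majorantConst (6 ^ 2) (2 * 6)) +
      Cd * (((1 + ‖iota2‖) * (‖iota3‖ + ‖iota4‖)) ^ 2 * majorantConst (6 ^ 2) (2 * 6) +
        majorantConst (2 ^ 2) (2 * 2)) with hc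
  obtain ⟨D₀, hall⟩ := (Phi3Eval.forAllLarge_le_ell ((5 : ℝ) ^ (10 : ℕ))).and
    (Phi3Eval.forAllLarge_le_ell (max 1 (|c| * (468 + 1).factorial / ε)))
  refine ⟨D₀, fun D _ χ hD hq hprim _hA p hp => ?_⟩
  obtain ⟨hℓ, hℓc⟩ := hall D χ hD hq hprim
  have h1 := Phi3Minus.norm_Phi3minus_sub_main_le c' χ hℓ hp
  have h2 := Phi3Minus.main_rhs_le c' χ hℓ hp hCρ0 (hCρ c' D χ) hCd1 hCd
  have h3 : c * ell D ^ 468 ≤ ε * D := Phi3Minus.ell_pow_le_eps_mul c 468 hε hℓc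
  have hp0 : (0 : ℝ) < p := pos_of_mem_primeWindow hp
  have hD0 : (0 : ℝ) < D := by
    have hℓ0 : 0 < ell D := lt_of_lt_of_le (by norm_num) hℓ
    rcases Nat.eq_zero_or_pos D with h | h
    · exfalso; simp [ell, h] at hℓ0
    · exact_mod_cast h
  refine (h1.trans h2).trans ?_
  rw [← hc]
  calc (p : ℝ) * (c * ell D ^ 468) / D ≤ (p : ℝ) * (ε * D) / D := by gcongr
    _ = ε * p := by field_simp

end Literature.NumberTheory.LFunctions.Zhang2022.Typed.Section17
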